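import Literature.Computability.Cryptography.AverageCase
import Literature.Computability.MetaComplexity.DistProblemsProofs
import Literature.Computability.MetaComplexity.AvgPOfAvgPLevin
import Literature.Computability.MetaComplexity.DistProblemsAvgPLevinProofs
import Literature.Computability.MetaComplexity.UniversalHeuristicSchemes
import Literature.Computability.MetaComplexity.UHSMachine
import Literature.Computability.MetaComplexity.OneSidedHeuristicsProofs
import Literature.Computability.MetaComplexity.SearchHeuristicSchemes
import Literature.Computability.MetaComplexity.UPSearchAssembly
import Literature.Computability.MetaComplexity.AvgCaseDerandomization
import Literature.Computability.MetaComplexity.LanguageCompressionProofs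
import Literature.Computability.MetaComplexity.DPReconstruction
import Literature.Computability.MetaComplexity.WeakSymmetryOfInformation
import Literature.Computability.MetaComplexity.AvgCaseDerandomizationBFP
import Literature.Computability.MetaComplexity.UniversalMachineProofs
import Literature.Computability.MetaComplexity.LanguageCompressionFinal
import Literature.Computability.MetaComplexity.DPReconstructionKParam
import Literature.Computability.MetaComplexity.AvgCaseDerandomizationPCP
import Literature.Computability.MetaComplexity.AvgCaseDerandomizationWeakPCP
import Literature.Computability.MetaComplexity.AvgCaseHardEFromPromiseBPP
import HarnessLib

/-!
# Crypto foundations: average-case complexity statements (proofs)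

Sibling proof file of `AverageCase.lean` (D-0014: named facts `def X : Prop` are discharged as
`theorem X_holds : X`; users' hypotheses `(h : X)` are then fed `X_holds`). It discharges the two
crypto-foundations.S14 sanity facts of that file whose interim proofs only depended on prelude
facts that are now theorems of the tree (`MetaComplexity/DistProblemsProofs.lean`):

* `Literature.Computability.Cryptography.distClass_NP_uniform_subset_DistNP_holds :
  distClass_NP_uniform_subset_DistNP` — `(NP, U) ⊆ DistNP = (NP, PSamp)`, because the uniform
  ensemble is polynomial-time samplable (`uniformEnsemble_mem_PSamp_holds`: the sampler outputs
  its first `n` coins);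
* `Literature.Computability.Cryptography.DistNP_inter_AvgP_subset_HeurP_holds :
  DistNP_inter_AvgP_subset_HeurP` — `DistNP ∩ AvgP ⊆ HeurP`, indeed `AvgP ⊆ HeurP`
  (`AvgP_subset_HeurP_holds`: replace the failure symbol `⊥` by the answer `0`).

The third S14 fact, `mem_AvgP_iff_mem_AvgPLevin_of_mem_DistNP` (Bogdanov–Trevisan Prop. 2.6 on
`DistNP`; arXiv cs/0606037v2, §2.2.1, Prop. 7), rests on the prelude fact
`mem_AvgP_iff_mem_AvgPLevin` (`MetaComplexity/DistProblems.lean`), now a theorem of the tree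
(`mem_AvgP_iff_mem_AvgPLevin_holds`, `MetaComplexity/DistProblemsAvgPLevinProofs.lean`, assembling
`mem_AvgP_of_mem_AvgPLevin` of `AvgPOfAvgPLevin.lean` and `mem_AvgPLevin_of_mem_AvgP` of
`AvgPLevinOfAvgP.lean`). Hence:

* `Literature.Computability.Cryptography.mem_AvgP_iff_mem_AvgPLevin_of_mem_DistNP_of` — the fact
  follows from the inclusion `AvgP ⊆ AvgPLevin` for ensembles with polynomially bounded support
  lengths (`Ensemble.HasPolyLength`, automatic on `DistNP` by
  `Ensemble.IsPolySamplable.hasPolyLength_holds`), the converse being `mem_AvgP_of_mem_AvgPLevin`;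
* `Literature.Computability.Cryptography.mem_AvgP_iff_mem_AvgPLevin_of_mem_DistNP_of_fact` — and,
  a fortiori, from the prelude fact `mem_AvgP_iff_mem_AvgPLevin` itself (the interim proof of
  `AverageCase.lean`, fed `hasPolyLength_holds`);
* `Literature.Computability.Cryptography.mem_AvgP_iff_mem_AvgPLevin_of_mem_DistNP_holds :
  mem_AvgP_iff_mem_AvgPLevin_of_mem_DistNP` — **the discharge**, `_of_fact` fed
  `mem_AvgP_iff_mem_AvgPLevin_holds` (first landed as p32381; re-landed after an unrelated
  whole-file resubmission, p31584, had overwritten it).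

## Hirahara's Thm. 1.6 (1) (crypto-foundations.S16): assembly

For the named fact `hirahara_UP_DistNP` (Hirahara, STOC 2021 = ECCC TR21-058, Thm. 1.6 (1):
`UP ⊄ DTIME(2^{O(n / log n)}) ⟹ DistNP ⊄ AvgP`) the printed proof (TR21-058, p. 12: "Observe that
Theorem 1.6 immediately follows from Lemmas 2.2 and 2.3") is the contrapositive of the chain
`DistNP ⊆ AvgP ⟹ (Lemma 2.2 (1)) every L ∈ UP has a universal heuristic scheme ⟹ (Lemma 2.3 =
Cor. 6.4) every L ∈ UP lies in DTIME(2^{O(n / log n)})`, both lemmas relative to a fixed efficient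
universal machine `U` (the paper's Def. 2.1; the tree's hypothesis structure
`MetaComplexity.UniversalMachine`). This file proves exactly this assembly, sorry-free:

* `hirahara_UP_DistNP_of` — from ONE universal machine `U` and the two lemmas *for that `U`*
  (the per-`U` instances of the named facts `Hirahara2021_hasUHS_of_mem_UP`,
  `Hirahara2021_mem_DTIME_of_hasUHS` of `MetaComplexity/UniversalHeuristicSchemes.lean`);
* `hirahara_UP_DistNP_of_facts` — from the three tree facts as stated: an efficient universal
  machine exists (`UniversalMachine.nonempty`, Arora–Barak Thm. 1.9 / Hennie–Stearns), Lemma 2.2 (1)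
  and Cor. 6.4 (both `∀ U`).

So the discharge `hirahara_UP_DistNP_holds` is reduced to discharging those named facts. Cor. 6.4
is now a theorem of the tree (`Hirahara2021_mem_DTIME_of_hasUHS_holds`, the `2^{O(n / log n)}`-time
TM2 machine of `MetaComplexity/UHSMachine.lean`), whence `hirahara_UP_DistNP_of_nonempty_of_hasUHS`:
only `UniversalMachine.nonempty` (clocked universal simulation on `Turing.FinTM2`) and Lemma 2.2 (1)
(the paper's §3.3–§5, §8) remain. Lemma 2.2 (1) is in turn reduced
(`MetaComplexity/OneSidedHeuristicsProofs.lean`, `Hirahara2021_hasUHS_of_mem_UP_of`: the proved step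
`DistNP ⊆ AvgP ⟹ coNP × {U, T} ⊆ Avg¹_{1-n^{-c}} P` of p. 9 / §11) to the `UP` case of the paper's
Cor. 8.12 (stated inline as a hypothesis: `coNP × {U, T} ⊆ Avg¹_{1-n^{-c}} P` for some `c` ⟹ every
`L ∈ UP` has a universal heuristic scheme), whence `hirahara_UP_DistNP_of_nonempty_of_UP_hasUHS_of_Avg1P`;
and Cor. 8.12 for `UP` is a proved theorem (`MetaComplexity/SearchHeuristicSchemes.lean`,
`Hirahara2021_UP_hasUHS_of_Avg1P_of_search`: a decision problem reduces to its search version) from the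
`UP`-verifier form of the paper's Thm. 8.9 (the named fact `Hirahara2021_UP_searchUHS_of_Avg1P`, the
only named fact of §8), whence `hirahara_UP_DistNP_of_nonempty_of_UP_searchUHS_of_Avg1P`.
Thm. 8.9 for `UP` is itself proved from its §3–§5 ingredients (`MetaComplexity/UPSearchAssembly.lean`),
whence `hirahara_UP_DistNP_of_nonempty_of_ingredients` / `_of_BFP`; and since the enumeration form of
Thm. 3.12 is now a theorem under `PromiseBPP' ⊆ PromiseP` (`Hirahara2021_dpEnum_of_PromiseBPP'_subset`,
`MetaComplexity/DPReconstruction.lean`: Goldreich–Levin decoding, XOR lemma, prefix search) and Lemma 5.1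
a theorem relative to Thm. 4.2 (`Hirahara2021_gapKvsK_mem_PromiseP_of_languageCompression`,
`MetaComplexity/LanguageCompressionProofs.lean`), the whole fact is reduced
(`hirahara_UP_DistNP_of_nonempty_of_languageCompression`) to `UniversalMachine.nonempty`, the named facts
Thm. 4.2 (`Hirahara2021_languageCompression`) and BFP Thm. 3.1
(`BuhrmanFortnowPavan2004_PromiseBPP'_subset_PromiseP`), and Thm. 5.2 in its printed form (inline).

## Update (2026-08-15): one leaf, and Buhrman–Fortnow–Pavan's Thm. 3.1 alone

* `hirahara_UP_DistNP_of_hardE` — the fact from ONE leaf: *`DistNP ⊆ AvgP` yields some `L ∈ E` and `ε > 0`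
  with `circuitSize(L, n) ≥ 2^{εn}` for all large `n`* (the hard language supplies both the generator of
  Lemma 3.4 and `pr-BPP = pr-P`, `PromiseBPP'_subset_PromiseP_of_avgHard_E`);
* `hirahara_UP_DistNP_of_BFP` — the fact from the named fact `BuhrmanFortnowPavan2004_PromiseBPP'_subset_PromiseP`
  ALONE: under `DistNP ⊆ AvgP`, `pr-BPP = pr-P` turns the Köbler–Schuler certifier of hard truth tables into an
  explicit construction (`MetaComplexity/AvgCaseHardEFromPromiseBPP.lean`, via the derandomised greedy search of
  `Complexity/DensePropertySearch.lean`, Goldreich 2011, §3.3, Prop. 3.8), i.e. into the leaf above. The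
  discharge is thus `hirahara_UP_DistNP_of_BFP BuhrmanFortnowPavan2004_PromiseBPP'_subset_PromiseP_holds` once
  that fact is discharged.

* `hirahara_UP_DistNP_of_weakPCP` — the same from WEAK probabilistically checkable proofs for `E` (soundness
  error `1 - 1/(m(n)+1)` for a polynomial `m`, the natural output of a sum-check / low-degree-test verifier):
  `pcpE_of_weak` (`MetaComplexity/AvgCaseDerandomizationWeakPCP.lean`, by the repetition
  `PCPVerifier.andRep` of `Complexity/PCPAmplification.lean`), then `hirahara_UP_DistNP_of_pcp`.

## The printed statements

Bogdanov–Trevisan (2006), §2.1: Def. 2.1 (arXiv cs/0606037v3, Def. 1) defines `PSamp`, and the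
text following it names the uniform ensemble `U = {Uₙ}` as the basic example and introduces the
distributional classes `(C, 𝔇)`, "in this survey we focus on `(NP, PSamp)`, `(NP, PComp)`, and
`(NP, U)`" — so `(NP, U) ⊆ (NP, PSamp)` is the remark that `U` is samplable. §2.2 closes with
"An errorless algorithm can be easily turned into a heuristic algorithm by replacing the failure
symbol `⊥` by an arbitrary output. Thus `Avg C ⊆ Heur C` …" (after arXiv v3 Def. 11), which on
`DistNP` is the second fact.

## References

* A. Bogdanov, L. Trevisan, *Average-Case Complexity*, Found. Trends TCS 2 (2006), §2.1
  (Def. 2.1 `PSamp`, the uniform ensemble, Def. 2.3 distributional classes) and §2.2 (closing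
  remark `Avg C ⊆ Heur C`); arXiv:cs/0606037v3, Def. 1 and the remark after Def. 11.
* R. Impagliazzo, *A personal view of average-case complexity*, CCC 1995, §2.
* S. Hirahara, *Average-case hardness of NP from exponential worst-case hardness assumptions*,
  STOC 2021, 292–302, doi:10.1145/3406325.3451065; full version ECCC TR21-058: Thm. 1.6,
  Lemma 2.2, Lemma 2.3, Cor. 6.4, §11 (p. 51: "Since `UP ⊆ NP_sv`, Item 1 of Theorem 1.6 is a
  special case of Theorem 11.1").
-/

namespace Literature.Computability.Cryptography

open _root_.Computability Complexity Complexity.Nondeterministic MetaComplexity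

/-- **Discharge of `distClass_NP_uniform_subset_DistNP`** (crypto-foundations.S14, samplable
ensembles): `(NP, U) ⊆ DistNP`, since `distClass` is monotone in the class of ensembles and the
uniform ensemble is polynomial-time samplable (`uniformEnsemble_mem_PSamp_holds`, i.e.
`{U} ⊆ PSamp`). This is the interim proof of `AverageCase.lean`, now fed the discharged prelude
fact. [Bogdanov–Trevisan 2006, §2.1 (Def. 2.1 and the example of the uniform ensemble; Def. 2.3)]
[cite: BogdanovTrevisan2006, §2.1 (Def. 2.1, example: the uniform ensemble; Def. 2.3)] -/
theorem distClass_NP_uniform_subset_DistNP_holds : distClass_NP_uniform_subset_DistNP := by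
  refine distClass_mono subset_rfl ?_
  rintro D rfl
  exact uniformEnsemble_mem_PSamp_holds

/-- **Discharge of `DistNP_inter_AvgP_subset_HeurP`** (crypto-foundations.S14, errorless
heuristics vs heuristics): `DistNP ∩ AvgP ⊆ HeurP`, indeed `AvgP ⊆ HeurP` for every ensemble
(`AvgP_subset_HeurP_holds`: answer `0` instead of `⊥`; the `DistNP` hypothesis is not used). This
is the interim proof of `AverageCase.lean`, now fed the discharged prelude fact.
[Bogdanov–Trevisan 2006, §2.2, closing remark (arXiv cs/0606037v3, after Def. 11)]
[cite: BogdanovTrevisan2006, §2.2 (closing remark: Avg C ⊆ Heur C)] -/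
theorem DistNP_inter_AvgP_subset_HeurP_holds : DistNP_inter_AvgP_subset_HeurP :=
  fun _ hQ => AvgP_subset_HeurP_holds hQ.2

/-! ### crypto-foundations.S14: `AvgP = AvgPLevin` on `DistNP`, reduced to `AvgP ⊆ AvgPLevin` -/

/-- **Reduction of `mem_AvgP_iff_mem_AvgPLevin_of_mem_DistNP` to the inclusion
`AvgP ⊆ AvgPLevin` under `HasPolyLength`.** Bogdanov–Trevisan's Prop. 2.6 (arXiv cs/0606037v2,
§2.2.1, Prop. 7: "a distributional problem admits a fully polynomial-time errorless heuristic
scheme if and only if it admits an algorithm whose running time is average-polynomial", under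
the standing convention `|x| ≤ poly(n)` on `supp Dₙ` of §2.1) restricted to `DistNP`: the
direction `AvgPLevin ⊆ AvgP` is the tree's `mem_AvgP_of_mem_AvgPLevin` (clocked simulation for
`(p(n)/δ)^{1/ε}` steps and Markov's inequality; valid for every ensemble), and on `DistNP` the
ensemble is polynomial-time samplable, hence has polynomially bounded support lengths
(`Ensemble.IsPolySamplable.hasPolyLength_holds`), so the remaining direction is exactly the
hypothesis `h` (the printed "run `A(x; n, δ)` for `δ = 1/2, 1/4, …` until an answer" half of
the proof of Prop. 7). [Bogdanov–Trevisan 2006, Def. 2.2, Def. 2.4, Prop. 2.6; arXiv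
cs/0606037v2, §2.2.1, Def. 3–4, Prop. 5, Def. 6, Prop. 7, Def. 8]
[cite: BogdanovTrevisan2006, Prop. 2.6 (arXiv cs/0606037v2, §2.2.1, Prop. 7)] -/
theorem mem_AvgP_iff_mem_AvgPLevin_of_mem_DistNP_of
    (h : ∀ {Q : DistProblem}, Q.dist.HasPolyLength → Q ∈ AvgP → Q ∈ AvgPLevin) :
    mem_AvgP_iff_mem_AvgPLevin_of_mem_DistNP :=
  fun hQ => ⟨h (Ensemble.IsPolySamplable.hasPolyLength_holds hQ.2), mem_AvgP_of_mem_AvgPLevin⟩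

/-- **Reduction of `mem_AvgP_iff_mem_AvgPLevin_of_mem_DistNP` to the prelude fact
`mem_AvgP_iff_mem_AvgPLevin`** (Bogdanov–Trevisan Prop. 2.6 for ensembles with `HasPolyLength`):
this is the interim proof of `AverageCase.lean`, the hypothesis `Q ∈ DistNP` supplying
`Q.dist.HasPolyLength` through the discharged `Ensemble.IsPolySamplable.hasPolyLength_holds`.
Hence `mem_AvgP_iff_mem_AvgPLevin_of_mem_DistNP_holds` is
`mem_AvgP_iff_mem_AvgPLevin_of_mem_DistNP_of_fact mem_AvgP_iff_mem_AvgPLevin_holds` as soon as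
the prelude fact is discharged. [Bogdanov–Trevisan 2006, Def. 2.2, Def. 2.4, Prop. 2.6, §2.1
(`|x| ≤ poly(n)`)] [cite: BogdanovTrevisan2006, Prop. 2.6 (arXiv cs/0606037v2, §2.2.1, Prop. 7)] -/
theorem mem_AvgP_iff_mem_AvgPLevin_of_mem_DistNP_of_fact (h : mem_AvgP_iff_mem_AvgPLevin) :
    mem_AvgP_iff_mem_AvgPLevin_of_mem_DistNP :=
  fun hQ => h (Ensemble.IsPolySamplable.hasPolyLength_holds hQ.2)

/-- **Discharge of `mem_AvgP_iff_mem_AvgPLevin_of_mem_DistNP`** (crypto-foundations.S14; Bogdanov–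
Trevisan Prop. 2.6 on `DistNP`): on `DistNP`, `(L, D) ∈ AvgP ↔ (L, D) ∈ AvgPLevin`, by
`mem_AvgP_iff_mem_AvgPLevin_of_mem_DistNP_of_fact` fed the discharged prelude fact
`mem_AvgP_iff_mem_AvgPLevin_holds` (`MetaComplexity/DistProblemsAvgPLevinProofs.lean`: the doubling
search `AvgP ⊆ AvgPLevin` under `HasPolyLength`, and the clocked simulation `AvgPLevin ⊆ AvgP`).
[Bogdanov–Trevisan 2006, §2.2.1, Prop. 7 (arXiv cs/0606037v2) = Prop. 2.6; Impagliazzo 1995, §2,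
Prop. 2] [cite: BogdanovTrevisan2006, Prop. 2.6 (arXiv cs/0606037v2, §2.2.1, Prop. 7)] -/
theorem mem_AvgP_iff_mem_AvgPLevin_of_mem_DistNP_holds : mem_AvgP_iff_mem_AvgPLevin_of_mem_DistNP :=
  mem_AvgP_iff_mem_AvgPLevin_of_mem_DistNP_of_fact mem_AvgP_iff_mem_AvgPLevin_holds

/-! ### crypto-foundations.S16: assembly of Hirahara's Thm. 1.6 (1) -/

/-- **Assembly of Hirahara's Thm. 1.6 (1) from Lemma 2.2 (1) and Lemma 2.3, for one universal
machine.** If, relative to some efficient universal machine `U`, (i) `DistNP ⊆ AvgP` implies that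
every `UP` language admits a universal heuristic scheme (Lemma 2.2 (1)) and (ii) every language
with a universal heuristic scheme lies in `DTIME(2^{O(n / log n)})` (Lemma 2.3 = Cor. 6.4), then
`UP ⊄ DTIME(2^{O(n / log n)}) ⟹ DistNP ⊄ AvgP` (contrapositive of (i) then (ii)).
[Hirahara 2021 (ECCC TR21-058), Thm. 1.6 (1), proof on p. 12 ("immediately follows from
Lemmas 2.2 and 2.3")] [cite: Hirahara2021, Thm. 1.6 (1)] -/
theorem hirahara_UP_DistNP_of (U : UniversalMachine)
    (h₁ : DistNP ⊆ AvgP → ∀ L ∈ UP, U.HasUniversalHeuristicScheme L)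
    (h₂ : ∀ L : Language Bool, U.HasUniversalHeuristicScheme L →
      L ∈ ⋃ c : ℕ, DTIME (fun n => 2 ^ (c * n / Nat.log 2 n))) :
    hirahara_UP_DistNP :=
  fun hUP hDist => hUP fun L hL => h₂ L (h₁ hDist L hL)

/-- **Assembly of Hirahara's Thm. 1.6 (1) from the tree's named facts.** Given an efficient
universal machine (`UniversalMachine.nonempty`), Lemma 2.2 (1) (`Hirahara2021_hasUHS_of_mem_UP`)
and Cor. 6.4 (`Hirahara2021_mem_DTIME_of_hasUHS`), the fact `hirahara_UP_DistNP` holds; its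
discharge is thus reduced to discharging these three facts.
[Hirahara 2021 (ECCC TR21-058), Thm. 1.6 (1), p. 12] [cite: Hirahara2021, Thm. 1.6 (1)] -/
theorem hirahara_UP_DistNP_of_facts (hU : UniversalMachine.nonempty)
    (h₁ : Hirahara2021_hasUHS_of_mem_UP) (h₂ : Hirahara2021_mem_DTIME_of_hasUHS) :
    hirahara_UP_DistNP := by
  obtain ⟨U⟩ := hU
  exact hirahara_UP_DistNP_of U (h₁ U) (h₂ U)

/-- **Hirahara's Thm. 1.6 (1), reduced to two named facts.** With Cor. 6.4 now a theorem of the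
tree (`Hirahara2021_mem_DTIME_of_hasUHS_holds`, `MetaComplexity/UHSMachine.lean`), the fact
`hirahara_UP_DistNP` follows from the existence of an efficient universal machine
(`UniversalMachine.nonempty`) and Lemma 2.2 (1) (`Hirahara2021_hasUHS_of_mem_UP`) alone.
[Hirahara 2021 (ECCC TR21-058), Thm. 1.6 (1), Lemma 2.2 (1), Lemma 2.3 / Cor. 6.4]
[cite: Hirahara2021, Thm. 1.6 (1)] -/
theorem hirahara_UP_DistNP_of_nonempty_of_hasUHS (hU : UniversalMachine.nonempty)
    (h₁ : Hirahara2021_hasUHS_of_mem_UP) : hirahara_UP_DistNP :=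
  hirahara_UP_DistNP_of_facts hU h₁ Hirahara2021_mem_DTIME_of_hasUHS_holds

/-- **Hirahara's Thm. 1.6 (1), reduced to the `UP` case of Cor. 8.12.** With Cor. 6.4 a theorem
(`Hirahara2021_mem_DTIME_of_hasUHS_holds`) and the first step of Lemma 2.2 (1) proved
(`Hirahara2021_hasUHS_of_mem_UP_of`: `DistNP ⊆ AvgP ⟹ coNP × {U, T} ⊆ Avg¹_{1-n^{-c}} P`,
`OneSidedHeuristicsProofs.lean`), the fact `hirahara_UP_DistNP` follows from the existence of an
efficient universal machine (`UniversalMachine.nonempty`) and the `UP` case of Cor. 8.12, taken here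
as the explicit hypothesis `h` — Cor. 8.12 specialised along Fact 8.4: if
`coNP × {U, T} ⊆ Avg¹_{1-n^{-c}} P` for some constant `c` then every `L ∈ UP` admits a universal
heuristic scheme, w.r.t. every efficient universal machine (the paper's Thm. 8.9 / Cor. 8.12, built
on §3.3–§5 and Lemma 3.4; a proved consequence of the named fact `Hirahara2021_UP_searchUHS_of_Avg1P`,
see the next theorem). This is the printed route of §11 (p. 51: "Since `UP ⊆ NP_sv`, Item 1 of
Theorem 1.6 is a special case of Theorem 11.1").
[Hirahara 2021 (ECCC TR21-058), Thm. 1.6 (1), Thm. 11.1, Cor. 8.12, Fact 8.4]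
[cite: Hirahara2021, Thm. 1.6 (1)] -/
theorem hirahara_UP_DistNP_of_nonempty_of_UP_hasUHS_of_Avg1P (hU : UniversalMachine.nonempty)
    (h : ∀ U : UniversalMachine,
      (∃ c : ℕ, distClass coNP {MetaComplexity.uniformEnsemble, tallyEnsemble} ⊆
        Avg1DeltaP fun n => 1 - 1 / (n : ℝ) ^ c) →
      ∀ L ∈ UP, U.HasUniversalHeuristicScheme L) :
    hirahara_UP_DistNP :=
  hirahara_UP_DistNP_of_nonempty_of_hasUHS hU (Hirahara2021_hasUHS_of_mem_UP_of h)

/-- **Hirahara's Thm. 1.6 (1), reduced to Thm. 8.9 (for `UP`-type verifiers).** Composing with the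
proved Cor. 8.12 for `UP` (`Hirahara2021_UP_hasUHS_of_Avg1P_of_search`, `SearchHeuristicSchemes.lean`:
the decision solver `x ↦ V(x, S(x; 1ᵗ, 1ᵐ))` turns a search scheme into a decision scheme), the fact
`hirahara_UP_DistNP` follows from an efficient universal machine (`UniversalMachine.nonempty`) and the
named fact `Hirahara2021_UP_searchUHS_of_Avg1P` — Thm. 8.9 for `UP`-type verifiers: if
`coNP × {U, T} ⊆ Avg¹_{1-n^{-c}} P` for some constant `c`, then every `UP`-type verifier admits a
universal heuristic scheme for its search problem (Def. 8.8). The remaining depth is exactly the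
paper's §8.2 construction (Lemma 3.4, Thm. 3.12, Thm. 4.2, Lemma 5.1, Thm. 5.2, Claims 8.10–8.11).
[Hirahara 2021 (ECCC TR21-058), Thm. 1.6 (1), Thm. 8.9, Cor. 8.12, Thm. 11.1]
[cite: Hirahara2021, Thm. 1.6 (1)] -/
theorem hirahara_UP_DistNP_of_nonempty_of_UP_searchUHS_of_Avg1P (hU : UniversalMachine.nonempty)
    (h : Hirahara2021_UP_searchUHS_of_Avg1P) : hirahara_UP_DistNP :=
  hirahara_UP_DistNP_of_nonempty_of_UP_hasUHS_of_Avg1P hU (Hirahara2021_UP_hasUHS_of_Avg1P_of_search h)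

/-- **Hirahara's Thm. 1.6 (1), reduced to the §3–§5 ingredients of Thm. 8.9.** With Thm. 8.9 for
`UP`-type verifiers now a theorem relative to its five ingredients
(`Hirahara2021_UP_searchUHS_of_Avg1P_of`, `MetaComplexity/UPSearchAssembly.lean`: the scheme,
Claims 8.10–8.11, `L' ∈ NP`, Fact 3.8, Eq. (13) and the running time are formalised), the fact
`hirahara_UP_DistNP` follows from an efficient universal machine (`UniversalMachine.nonempty`), the
named facts Lemma 5.1 (`Hirahara2021_gapKvsK_mem_PromiseP`) and Thm. 4.2
(`Hirahara2021_languageCompression`), and the three remaining printed statements taken as hypotheses: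
Thm. 5.2 (weak symmetry of information) in its printed form (`h52`: under
`coNP × {U, T} ⊆ Avg¹_{1-n^{-c}} P` there are polynomials `p₀, p_w` with
`Pr_{w ← {0,1}^m}[K^t(xw) ≥ K^{p_w(t/ε)}(x) + m - log p_w(t/ε)] ≥ 1 - ε` for all `n, m`, `t ≥ p₀(nm)`,
`ε = 1/e`, `x ∈ {0,1}ⁿ`; an inline hypothesis and not a named fact since the D-0026 review of
2026-08-15, see `MetaComplexity/UPSearchAssembly.lean`), Lemma 3.4 in promise form (`pr-BPP = pr-P`
under `coNP × {U, T} ⊆ Avg¹_{1-n^{-c}} P`) and Thm. 3.12 in enumeration form (for polynomial-time tests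
with auxiliary input). [Hirahara 2021 (ECCC TR21-058), Thm. 1.6 (1), Thm. 8.9, Lemma 3.4, Thm. 3.12,
Thm. 4.2, Lemma 5.1, Thm. 5.2] [cite: Hirahara2021, Thm. 1.6 (1)] -/
theorem hirahara_UP_DistNP_of_nonempty_of_ingredients (hU : UniversalMachine.nonempty)
    (h51 : Hirahara2021_gapKvsK_mem_PromiseP) (h42 : Hirahara2021_languageCompression)
    (h52 : ∀ U : UniversalMachine,
      (∃ c : ℕ, distClass coNP {MetaComplexity.uniformEnsemble, tallyEnsemble} ⊆
        Avg1DeltaP fun n => 1 - 1 / (n : ℝ) ^ c) →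
      ∃ p₀ pw : Polynomial ℕ, ∀ (n m t e : ℕ) (x : List Bool), x.length = n → p₀.eval (n * m) ≤ t →
        1 ≤ e →
          1 - 1 / (e : ℝ) ≤ uniformProb m
            {w | U.ktAt (pw.eval (t * e)) x + m ≤ U.ktAt t (x ++ w) + Nat.log 2 (pw.eval (t * e))})
    (h34 : (∃ c : ℕ, distClass coNP {MetaComplexity.uniformEnsemble, tallyEnsemble} ⊆
        Avg1DeltaP fun n => 1 - 1 / (n : ℝ) ^ c) → PromiseBPP' ⊆ PromiseP)
    (h312 : (∃ c : ℕ, distClass coNP {MetaComplexity.uniformEnsemble, tallyEnsemble} ⊆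
        Avg1DeltaP fun n => 1 - 1 / (n : ℝ) ^ c) →
      ∀ D₀ : Language Bool, D₀ ∈ Classes.P → ∃ E : List Bool → List Bool, E ∈ FP ∧
        ∀ (a x : List Bool) (k e : ℕ), 1 ≤ e →
          1 / (e : ℝ) ≤ dpAdvantage k x (fun w => D₀.boolIndicator (boolPair a w)) →
            x ∈ Brick.decNil (E (dpEnumEnc a x.length k e))) :
    hirahara_UP_DistNP :=
  hirahara_UP_DistNP_of_nonempty_of_UP_searchUHS_of_Avg1P hU
    (Hirahara2021_UP_searchUHS_of_Avg1P_of h51 h42 h52 h34 h312)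

/-- **Hirahara's Thm. 1.6 (1) with the derandomisation supplied by Buhrman–Fortnow–Pavan.** Along
the chain `UP ⊄ DTIME(2^{O(n/log n)}) ⟸ (DistNP ⊆ AvgP ⟹ every L ∈ UP has a universal heuristic
scheme)` (`hirahara_UP_DistNP_of`), the hypothesis `DistNP ⊆ AvgP` is available, so Lemma 3.4's role
(`pr-BPP = pr-P`) is played by the tree's named fact `BuhrmanFortnowPavan2004_PromiseBPP'_subset_PromiseP`
(`DistNP ⊆ AvgP ⟹ PromiseBPP' ⊆ PromiseP`), and `coNP × {U, T} ⊆ Avg¹_{1-1/n} P` by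
`distClass_coNP_subset_Avg1DeltaP_of_DistNP_subset_AvgP`. Hence `hirahara_UP_DistNP` follows from
`UniversalMachine.nonempty`, the named facts Lemma 5.1, Thm. 4.2 (Hirahara 2021) and BFP (Thm. 3.1),
and the two remaining hypotheses: Thm. 5.2 (weak symmetry of information) in its printed form (`h52`,
as in `hirahara_UP_DistNP_of_nonempty_of_ingredients`) and Thm. 3.12 in enumeration form.
[Hirahara 2021 (ECCC TR21-058), Thm. 1.6 (1), Thm. 8.9, Cor. 8.12, Cor. 6.4, Thm. 5.2;
Buhrman–Fortnow–Pavan 2005, Thm. 3.1] [cite: Hirahara2021, Thm. 1.6 (1)] -/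
theorem hirahara_UP_DistNP_of_nonempty_of_BFP (hU : UniversalMachine.nonempty)
    (h51 : Hirahara2021_gapKvsK_mem_PromiseP) (h42 : Hirahara2021_languageCompression)
    (h52 : ∀ U : UniversalMachine,
      (∃ c : ℕ, distClass coNP {MetaComplexity.uniformEnsemble, tallyEnsemble} ⊆
        Avg1DeltaP fun n => 1 - 1 / (n : ℝ) ^ c) →
      ∃ p₀ pw : Polynomial ℕ, ∀ (n m t e : ℕ) (x : List Bool), x.length = n → p₀.eval (n * m) ≤ t →
        1 ≤ e →
          1 - 1 / (e : ℝ) ≤ uniformProb m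
            {w | U.ktAt (pw.eval (t * e)) x + m ≤ U.ktAt t (x ++ w) + Nat.log 2 (pw.eval (t * e))})
    (hBFP : BuhrmanFortnowPavan2004_PromiseBPP'_subset_PromiseP)
    (h312 : (∃ c : ℕ, distClass coNP {MetaComplexity.uniformEnsemble, tallyEnsemble} ⊆
        Avg1DeltaP fun n => 1 - 1 / (n : ℝ) ^ c) →
      ∀ D₀ : Language Bool, D₀ ∈ Classes.P → ∃ E : List Bool → List Bool, E ∈ FP ∧
        ∀ (a x : List Bool) (k e : ℕ), 1 ≤ e →
          1 / (e : ℝ) ≤ dpAdvantage k x (fun w => D₀.boolIndicator (boolPair a w)) →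
            x ∈ Brick.decNil (E (dpEnumEnc a x.length k e))) :
    hirahara_UP_DistNP := by
  obtain ⟨U⟩ := hU
  refine hirahara_UP_DistNP_of U (fun hDist L hL => ?_) (Hirahara2021_mem_DTIME_of_hasUHS_holds U)
  have hyp : ∃ c : ℕ, distClass coNP {MetaComplexity.uniformEnsemble, tallyEnsemble} ⊆
      Avg1DeltaP fun n => 1 - 1 / (n : ℝ) ^ c :=
    ⟨1, distClass_coNP_subset_Avg1DeltaP_of_DistNP_subset_AvgP hDist one_ne_zero⟩
  obtain ⟨R, hR, p, hver, hsub⟩ := hL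
  obtain ⟨τ, hτ⟩ := h51 U hyp
  obtain ⟨pc, hpc⟩ := h42 U hyp (U.upLang R p) (U.upLang_mem_NP hR p)
    (UniversalMachine.isLanguageEnsemble_upLang R p)
  obtain ⟨p₀, pw, hsoi⟩ := h52 U hyp
  obtain ⟨S, C, hSC⟩ := U.hasSearchUHS_of_ingredients hR p hsub hτ hpc (hBFP hDist) (h312 hyp)
    (U.weakSOI_failure_le hsoi)
  exact (hSC.isUniversalHeuristicScheme hR hver).hasUniversalHeuristicScheme

/-! ### `hirahara_UP_DistNP` from `UniversalMachine.nonempty`, Thm. 4.2, BFP and Thm. 5.2 (printed form) -/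

/-- **Hirahara's Thm. 1.6 (1) from an efficient universal machine, Thm. 4.2 (algorithmic language
compression), Buhrman–Fortnow–Pavan's Thm. 3.1 and Thm. 5.2 (weak symmetry of information, printed form).**
Compared with `hirahara_UP_DistNP_of_nonempty_of_BFP`, the two remaining leaves of Thm. 8.9 that were
hypotheses there are discharged: Lemma 5.1 is Thm. 4.2 applied to the `NP` ensemble `{x | K^t(x) ≤ s}`
(`Hirahara2021_gapKvsK_mem_PromiseP_of_languageCompression`, p. 29), and the enumeration form of Thm. 3.12
for polynomial-time tests with auxiliary input is a theorem under `PromiseBPP' ⊆ PromiseP`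
(`Hirahara2021_dpEnum_of_PromiseBPP'_subset`: one run of the Goldreich–Levin reconstruction succeeds with
probability `≥ 1/(4e·2^k·2^kk)`, and heavy outputs of a randomised polynomial-time function can be listed
deterministically under `pr-BPP = pr-P`), the latter hypothesis being supplied along the chain by BFP under
`DistNP ⊆ AvgP`. Hence `hirahara_UP_DistNP` follows from `UniversalMachine.nonempty`, the named facts
`Hirahara2021_languageCompression` (Thm. 4.2) and `BuhrmanFortnowPavan2004_PromiseBPP'_subset_PromiseP`
(BFP Thm. 3.1), and the single remaining inline hypothesis `h52`: Thm. 5.2 in its printed form (whose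
printed proof needs the `K`-complexity form of Thm. 3.12, i.e. the generator of Lemma 3.4; see
`UPSearchAssembly.lean`, "Size of what remains"). [Hirahara 2021 (ECCC TR21-058), Thm. 1.6 (1) via
Lemma 2.2 (1), Lemma 2.3 = Cor. 6.4, Thm. 8.9, Cor. 8.12, Fact 8.4; Thm. 3.12, Thm. 4.2, Lemma 5.1,
Thm. 5.2; Buhrman–Fortnow–Pavan 2005, Thm. 3.1] [cite: Hirahara2021, Thm. 1.6 (1)] -/
theorem hirahara_UP_DistNP_of_nonempty_of_languageCompression (hU : UniversalMachine.nonempty)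
    (h42 : Hirahara2021_languageCompression)
    (h52 : ∀ U : UniversalMachine,
      (∃ c : ℕ, distClass coNP {MetaComplexity.uniformEnsemble, tallyEnsemble} ⊆
        Avg1DeltaP fun n => 1 - 1 / (n : ℝ) ^ c) →
      ∃ p₀ pw : Polynomial ℕ, ∀ (n m t e : ℕ) (x : List Bool), x.length = n → p₀.eval (n * m) ≤ t →
        1 ≤ e →
          1 - 1 / (e : ℝ) ≤ uniformProb m
            {w | U.ktAt (pw.eval (t * e)) x + m ≤ U.ktAt t (x ++ w) + Nat.log 2 (pw.eval (t * e))})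
    (hBFP : BuhrmanFortnowPavan2004_PromiseBPP'_subset_PromiseP) :
    hirahara_UP_DistNP := by
  obtain ⟨U⟩ := hU
  refine hirahara_UP_DistNP_of U (fun hDist L hL => ?_) (Hirahara2021_mem_DTIME_of_hasUHS_holds U)
  have hyp : ∃ c : ℕ, distClass coNP {MetaComplexity.uniformEnsemble, tallyEnsemble} ⊆
      Avg1DeltaP fun n => 1 - 1 / (n : ℝ) ^ c :=
    ⟨1, distClass_coNP_subset_Avg1DeltaP_of_DistNP_subset_AvgP hDist one_ne_zero⟩
  obtain ⟨R, hR, p, hver, hsub⟩ := hL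
  obtain ⟨τ, hτ⟩ := Hirahara2021_gapKvsK_mem_PromiseP_of_languageCompression h42 U hyp
  obtain ⟨pc, hpc⟩ := h42 U hyp (U.upLang R p) (U.upLang_mem_NP hR p)
    (UniversalMachine.isLanguageEnsemble_upLang R p)
  obtain ⟨p₀, pw, hsoi⟩ := h52 U hyp
  obtain ⟨S, C, hSC⟩ := U.hasSearchUHS_of_ingredients hR p hsub hτ hpc (hBFP hDist)
    (Hirahara2021_dpEnum_of_PromiseBPP'_subset (hBFP hDist)) (U.weakSOI_failure_le hsoi)
  exact (hSC.isUniversalHeuristicScheme hR hver).hasUniversalHeuristicScheme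

/-! ### `hirahara_UP_DistNP` from Thm. 4.2 and Buhrman–Fortnow–Pavan's Lemma 3.7 -/

/-- **Hirahara's Thm. 1.6 (1) from Thm. 4.2 (algorithmic language compression) and Buhrman–Fortnow–Pavan's
Lemma 3.7.** Compared with `hirahara_UP_DistNP_of_nonempty_of_languageCompression`, the two remaining
non-literature inputs are discharged: the efficient universal machine exists
(`UniversalMachine.nonempty_holds`, `UniversalMachineProofs.lean`), and Thm. 5.2 (weak symmetry of
information, the former hypothesis `h52`) is now a theorem relative to the quick pseudorandom generator of
Lemma 3.4 and `Gap(K vs K) ∈ pr-P` (`Hirahara2021_weakSOI_of_PRG`, `WeakSymmetryOfInformation.lean`, through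
the `K`-complexity form of Thm. 3.12, `Hirahara2021_dpReconstructionK`). Along the chain the hypothesis
`DistNP ⊆ AvgP` is available, so the generator is supplied by the tree's hardness-versus-randomness theorems
(`exists_isSizePseudorandom_of_avgHard_E`, Nisan–Wigderson; `exists_avgHard_E_of_hard_E`,
Impagliazzo–Wigderson) from a hard language in `E`, which Buhrman–Fortnow–Pavan's proof of their Thm. 3.1
produces from their Lemma 3.7 (`exists_hard_E_of_DistNP_subset_AvgP_of_lemma37`); `pr-BPP = pr-P` likewise
(`BuhrmanFortnowPavan2004_PromiseBPP'_subset_PromiseP_of_lemma37`). Hence `hirahara_UP_DistNP` follows from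
the named fact `Hirahara2021_languageCompression` (Thm. 4.2) and the single inline hypothesis `h37` — BFP's
Lemma 3.7 (the probabilistically-checkable-proofs + Köbler–Schuler step), in the exact form of the tree's
reduction of `BuhrmanFortnowPavan2004_PromiseBPP'_subset_PromiseP` (`AvgCaseDerandomizationBFP.lean`).
[Hirahara 2021 (ECCC TR21-058), Thm. 1.6 (1) via Lemma 2.2 (1), Lemma 2.3 = Cor. 6.4, Thm. 8.9, Cor. 8.12,
Fact 8.4; Thm. 3.12, Lemma 3.4, Thm. 4.2, Lemma 5.1, Thm. 5.2; Buhrman–Fortnow–Pavan 2005, Thm. 3.1 (proof),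
Lemma 3.7; Nisan–Wigderson 1994; Impagliazzo–Wigderson 1997] [cite: Hirahara2021, Thm. 1.6 (1)] -/
theorem hirahara_UP_DistNP_of_languageCompression_of_lemma37 (h42 : Hirahara2021_languageCompression)
    (h37 : DistNP ⊆ AvgP →
      (∀ A ∈ E, ∀ ε : ℝ, 0 < ε → ∃ᶠ n : ℕ in Filter.atTop, (A.circuitSize n : ℝ) ≤ (2 : ℝ) ^ (ε * n)) →
      ∀ A ∈ E, ∃ B ∈ NTIME (fun n => 2 ^ n), ∃ᶠ n : ℕ in Filter.atTop,
        ∀ x : List Bool, x.length = n → (x ∈ A ↔ x ∈ B)) :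
    hirahara_UP_DistNP := by
  obtain ⟨U⟩ := UniversalMachine.nonempty_holds
  refine hirahara_UP_DistNP_of U (fun hDist L hL => ?_) (Hirahara2021_mem_DTIME_of_hasUHS_holds U)
  -- the generator of Lemma 3.4 and `pr-BPP = pr-P`, from Lemma 3.7 under `DistNP ⊆ AvgP`
  obtain ⟨L₁, hL₁, ε, hε, hhard⟩ := exists_avgHard_E_of_hard_E (exists_hard_E_of_DistNP_subset_AvgP_of_lemma37 h37 hDist)
  have hPRG : ∃ (F : List Bool → List Bool) (c : ℕ), F ∈ FP ∧
      ∀ᶠ N in Filter.atTop, IsSizePseudorandom (seedGenerator F (c * Nat.log 2 N + c) N) := by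
    obtain ⟨F, c, hF, h⟩ := exists_isSizePseudorandom_of_avgHard_E hL₁ hε hhard
    exact ⟨F, c, hF, h⟩
  have hBPP : PromiseBPP' ⊆ PromiseP := BuhrmanFortnowPavan2004_PromiseBPP'_subset_PromiseP_of_lemma37 h37 hDist
  -- the ingredients of Thm. 8.9
  have hyp : ∃ c : ℕ, distClass coNP {MetaComplexity.uniformEnsemble, tallyEnsemble} ⊆
      Avg1DeltaP fun n => 1 - 1 / (n : ℝ) ^ c :=
    ⟨1, distClass_coNP_subset_Avg1DeltaP_of_DistNP_subset_AvgP hDist one_ne_zero⟩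
  obtain ⟨R, hR, p, hver, hsub⟩ := hL
  have h51 := Hirahara2021_gapKvsK_mem_PromiseP_of_languageCompression h42 U hyp
  obtain ⟨τ, hτ⟩ := h51
  obtain ⟨pc, hpc⟩ := h42 U hyp (U.upLang R p) (U.upLang_mem_NP hR p)
    (UniversalMachine.isLanguageEnsemble_upLang R p)
  obtain ⟨p₀, pw, hsoi⟩ := Hirahara2021_weakSOI_of_PRG U hPRG ⟨τ, hτ⟩
  obtain ⟨S, C, hSC⟩ := U.hasSearchUHS_of_ingredients hR p hsub hτ hpc hBPP
    (Hirahara2021_dpEnum_of_PromiseBPP'_subset hBPP) (U.weakSOI_failure_le hsoi)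
  exact (hSC.isUniversalHeuristicScheme hR hver).hasUniversalHeuristicScheme

/-! ### `hirahara_UP_DistNP` from Buhrman–Fortnow–Pavan's Lemma 3.7 alone -/

/-- **Hirahara's Thm. 1.6 (1) from Buhrman–Fortnow–Pavan's Lemma 3.7 alone.** Compared with
`hirahara_UP_DistNP_of_languageCompression_of_lemma37`, the named fact `Hirahara2021_languageCompression`
(Thm. 4.2, algorithmic language compression) is discharged along the chain: the tree proves Thm. 4.2
relative to Lemma 3.4 in promise form (`h34 : coNP × {U, T} ⊆ Avg¹P → pr-BPP = pr-P`) and the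
`K`-complexity form of Thm. 3.12 (`h312K`) — `Hirahara2021_languageCompression_of`
(`LanguageCompressionFinal.lean`: Lemma 3.6, Lemma 4.5 with the Goldwasser–Sipser protocol of Lemma 4.6,
`L' ∈ NP`, Claim 4.7 and the final bounds). Under `DistNP ⊆ AvgP`, which is in force along the chain,
both hypotheses hold outright: `pr-BPP = pr-P` by `BuhrmanFortnowPavan2004_PromiseBPP'_subset_PromiseP_of_lemma37`,
and Thm. 3.12 in `K`-form by `DPK.Hirahara2021_dpReconstructionK_param` (`DPReconstructionKParam.lean`, from
`DPK.Hirahara2021_dpReconstructionK`) fed with the quick pseudorandom generator that the tree's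
hardness-versus-randomness theorems (`exists_isSizePseudorandom_of_avgHard_E`, Nisan–Wigderson;
`exists_avgHard_E_of_hard_E`, Impagliazzo–Wigderson) extract from the hard language in `E` of BFP's proof
of their Thm. 3.1 (`exists_hard_E_of_DistNP_subset_AvgP_of_lemma37`). Hence `hirahara_UP_DistNP` follows
from the single inline hypothesis `h37` — BFP's Lemma 3.7 (the probabilistically-checkable-proofs +
Köbler–Schuler step), in the exact form of the tree's reduction of
`BuhrmanFortnowPavan2004_PromiseBPP'_subset_PromiseP` (`AvgCaseDerandomizationBFP.lean`); every result of
Hirahara's paper on the path Thm. 1.6 (1) ⇐ Lemma 2.2 (1) + Lemma 2.3 (Cor. 6.4, Thm. 8.9, Cor. 8.12,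
Fact 8.4, Thm. 3.12, Thm. 4.2, Lemma 4.5, Lemma 4.6, Claim 4.7, Lemma 5.1, Thm. 5.2, Fact 3.8) is now a
theorem of the tree, and of Lemma 3.4's four ingredients only item 3 (BFP: `NE = E ∧ pr-MA = pr-NP ⟹
E ⊄ i.o.SIZE(2^{εn})`, here in BFP's own Lemma-3.7 form) remains hypothetical.
[Hirahara 2021 (ECCC TR21-058), Thm. 1.6 (1) via Lemma 2.2 (1), Lemma 2.3 = Cor. 6.4, Thm. 8.9, Cor. 8.12,
Fact 8.4; Thm. 3.12, Lemma 3.4, Thm. 4.2, Lemma 5.1, Thm. 5.2; Buhrman–Fortnow–Pavan 2005, Thm. 3.1 (proof),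
Lemma 3.7; Nisan–Wigderson 1994; Impagliazzo–Wigderson 1997] [cite: Hirahara2021, Thm. 1.6 (1)] -/
theorem hirahara_UP_DistNP_of_lemma37
    (h37 : DistNP ⊆ AvgP →
      (∀ A ∈ E, ∀ ε : ℝ, 0 < ε → ∃ᶠ n : ℕ in Filter.atTop, (A.circuitSize n : ℝ) ≤ (2 : ℝ) ^ (ε * n)) →
      ∀ A ∈ E, ∃ B ∈ NTIME (fun n => 2 ^ n), ∃ᶠ n : ℕ in Filter.atTop,
        ∀ x : List Bool, x.length = n → (x ∈ A ↔ x ∈ B)) :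
    hirahara_UP_DistNP := by
  obtain ⟨U⟩ := UniversalMachine.nonempty_holds
  refine hirahara_UP_DistNP_of U (fun hDist L hL => ?_) (Hirahara2021_mem_DTIME_of_hasUHS_holds U)
  -- the generator of Lemma 3.4 and `pr-BPP = pr-P`, from Lemma 3.7 under `DistNP ⊆ AvgP`
  obtain ⟨L₁, hL₁, ε, hε, hhard⟩ := exists_avgHard_E_of_hard_E (exists_hard_E_of_DistNP_subset_AvgP_of_lemma37 h37 hDist)
  have hPRG : ∃ (F : List Bool → List Bool) (c : ℕ), F ∈ FP ∧
      ∀ᶠ N in Filter.atTop, IsSizePseudorandom (seedGenerator F (c * Nat.log 2 N + c) N) := by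
    obtain ⟨F, c, hF, h⟩ := exists_isSizePseudorandom_of_avgHard_E hL₁ hε hhard
    exact ⟨F, c, hF, h⟩
  have hBPP : PromiseBPP' ⊆ PromiseP := BuhrmanFortnowPavan2004_PromiseBPP'_subset_PromiseP_of_lemma37 h37 hDist
  -- Thm. 4.2 along the chain: Lemma 3.4 (promise form) and Thm. 3.12 (`K`-form) hold outright here
  have h42 : Hirahara2021_languageCompression :=
    Hirahara2021_languageCompression_of (fun _ => hBPP)
      fun U' _ D₀ hD₀ => DPK.Hirahara2021_dpReconstructionK_param U' hPRG hD₀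
  -- the ingredients of Thm. 8.9
  have hyp : ∃ c : ℕ, distClass coNP {MetaComplexity.uniformEnsemble, tallyEnsemble} ⊆
      Avg1DeltaP fun n => 1 - 1 / (n : ℝ) ^ c :=
    ⟨1, distClass_coNP_subset_Avg1DeltaP_of_DistNP_subset_AvgP hDist one_ne_zero⟩
  obtain ⟨R, hR, p, hver, hsub⟩ := hL
  obtain ⟨τ, hτ⟩ := Hirahara2021_gapKvsK_mem_PromiseP_of_languageCompression h42 U hyp
  obtain ⟨pc, hpc⟩ := h42 U hyp (U.upLang R p) (U.upLang_mem_NP hR p)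
    (UniversalMachine.isLanguageEnsemble_upLang R p)
  obtain ⟨p₀, pw, hsoi⟩ := Hirahara2021_weakSOI_of_PRG U hPRG ⟨τ, hτ⟩
  obtain ⟨S, C, hSC⟩ := U.hasSearchUHS_of_ingredients hR p hsub hτ hpc hBPP
    (Hirahara2021_dpEnum_of_PromiseBPP'_subset hBPP) (U.weakSOI_failure_le hsoi)
  exact (hSC.isUniversalHeuristicScheme hR hver).hasUniversalHeuristicScheme

/-! ### `hirahara_UP_DistNP` from a single leaf: a `2^{εn}`-hard language in `E` under `DistNP ⊆ AvgP` -/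

/-- **Hirahara's Thm. 1.6 (1) from ONE leaf — a language in `E` of circuit complexity `≥ 2^{εn}` at all
large `n` under `DistNP ⊆ AvgP`** (items 1–3 of the proof sketch of Lemma 3.4, p. 20: [BCGL92] + [KS04] +
[BFP05]). Compared with `hirahara_UP_DistNP_of_lemma37`, Buhrman–Fortnow–Pavan's Lemma 3.7 is no longer
asked for: along the chain `DistNP ⊆ AvgP ⟹ every L ∈ UP has a universal heuristic scheme`
(`hirahara_UP_DistNP_of`) the hard language supplies both the quick pseudorandom generator of Lemma 3.4
(`exists_avgHard_E_of_hard_E`, Impagliazzo–Wigderson; `exists_isSizePseudorandom_of_avgHard_E`,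
Nisan–Wigderson) and `pr-BPP = pr-P` (`PromiseBPP'_subset_PromiseP_of_avgHard_E`, Arora–Barak Lemma 20.3 in
promise form), whence Thm. 4.2 (`Hirahara2021_languageCompression_of` with the `K`-form of Thm. 3.12,
`DPK.Hirahara2021_dpReconstructionK_param`), Lemma 5.1, Thm. 5.2 (`Hirahara2021_weakSOI_of_PRG`), Thm. 3.12
in enumeration form (`Hirahara2021_dpEnum_of_PromiseBPP'_subset`) and Thm. 8.9 / Cor. 8.12 for `UP`
(`UniversalMachine.hasSearchUHS_of_ingredients`), closed by Cor. 6.4 (`Hirahara2021_mem_DTIME_of_hasUHS_holds`).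
So the named fact holds as soon as `DistNP ⊆ AvgP` yields SOME `L ∈ E` and `ε > 0` with
`circuitSize(L, n) ≥ 2^{εn}` for all large `n`, by whatever route — BFP's Lemma 3.7
(`exists_hard_E_of_DistNP_subset_AvgP_of_lemma37`), or `pr-BPP = pr-P` together with the Köbler–Schuler
certifier of hard truth tables (`exists_certifier_of_DistNP_subset_AvgP`).
[Hirahara 2021 (ECCC TR21-058), Thm. 1.6 (1) via Lemma 2.2 (1), Lemma 2.3 = Cor. 6.4, Thm. 8.9, Cor. 8.12;
Lemma 3.4 (proof sketch, items 1–4, p. 20); Thm. 3.12, Thm. 4.2, Lemma 5.1, Thm. 5.2]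
[cite: Hirahara2021, Thm. 1.6 (1) and Lemma 3.4 (proof sketch, p. 20)] -/
theorem hirahara_UP_DistNP_of_hardE
    (hE : DistNP ⊆ AvgP →
      ∃ L ∈ E, ∃ ε : ℝ, 0 < ε ∧ ∀ᶠ n : ℕ in Filter.atTop, (2 : ℝ) ^ (ε * n) ≤ (L.circuitSize n : ℝ)) :
    hirahara_UP_DistNP := by
  obtain ⟨U⟩ := UniversalMachine.nonempty_holds
  refine hirahara_UP_DistNP_of U (fun hDist L hL => ?_) (Hirahara2021_mem_DTIME_of_hasUHS_holds U)
  -- the generator of Lemma 3.4 and `pr-BPP = pr-P`, from the hard language under `DistNP ⊆ AvgP`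
  obtain ⟨L₁, hL₁, ε, hε, hhard⟩ := exists_avgHard_E_of_hard_E (hE hDist)
  have hPRG : ∃ (F : List Bool → List Bool) (c : ℕ), F ∈ FP ∧
      ∀ᶠ N in Filter.atTop, IsSizePseudorandom (seedGenerator F (c * Nat.log 2 N + c) N) := by
    obtain ⟨F, c, hF, h⟩ := exists_isSizePseudorandom_of_avgHard_E hL₁ hε hhard
    exact ⟨F, c, hF, h⟩
  have hBPP : PromiseBPP' ⊆ PromiseP := PromiseBPP'_subset_PromiseP_of_avgHard_E hL₁ hε hhard
  -- Thm. 4.2 along the chain: Lemma 3.4 (promise form) and Thm. 3.12 (`K`-form) hold outright here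
  have h42 : Hirahara2021_languageCompression :=
    Hirahara2021_languageCompression_of (fun _ => hBPP)
      fun U' _ D₀ hD₀ => DPK.Hirahara2021_dpReconstructionK_param U' hPRG hD₀
  -- the ingredients of Thm. 8.9
  have hyp : ∃ c : ℕ, distClass coNP {MetaComplexity.uniformEnsemble, tallyEnsemble} ⊆
      Avg1DeltaP fun n => 1 - 1 / (n : ℝ) ^ c :=
    ⟨1, distClass_coNP_subset_Avg1DeltaP_of_DistNP_subset_AvgP hDist one_ne_zero⟩
  obtain ⟨R, hR, p, hver, hsub⟩ := hL
  obtain ⟨τ, hτ⟩ := Hirahara2021_gapKvsK_mem_PromiseP_of_languageCompression h42 U hyp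
  obtain ⟨pc, hpc⟩ := h42 U hyp (U.upLang R p) (U.upLang_mem_NP hR p)
    (UniversalMachine.isLanguageEnsemble_upLang R p)
  obtain ⟨p₀, pw, hsoi⟩ := Hirahara2021_weakSOI_of_PRG U hPRG ⟨τ, hτ⟩
  obtain ⟨S, C, hSC⟩ := U.hasSearchUHS_of_ingredients hR p hsub hτ hpc hBPP
    (Hirahara2021_dpEnum_of_PromiseBPP'_subset hBPP) (U.weakSOI_failure_le hsoi)
  exact (hSC.isUniversalHeuristicScheme hR hver).hasUniversalHeuristicScheme

/-! ### `hirahara_UP_DistNP` from Buhrman–Fortnow–Pavan's Thm. 3.3 (PCPs for `E`) alone -/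

/-- **Hirahara's Thm. 1.6 (1) from probabilistically checkable proofs for `E` alone.** Compared with
`hirahara_UP_DistNP_of_lemma37`, BFP's Lemma 3.7 is discharged along its printed proof
(`BFP_lemma37_of_pcp_of_DistNP`, `AvgCaseDerandomizationPCP.lean`: the Merlin–Arthur protocol of
Lemma 3.4 with Merlin's small circuit for the proof-bit language, Köbler–Schuler's `pr-MA ⊆ pr-NP`
under `DistNP ⊆ AvgP`, and the `NTIME(2ⁿ)` scaling of exponential Merlin–Arthur protocols), leaving as
the single inline hypothesis BFP's **Thm. 3.3** — probabilistically checkable proofs for `E`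
(Babai–Fortnow–Levin–Szegedy 1991 / Polishchuk–Spielman 1994), stated in the tree's model of
nonadaptive PCP verifiers: every `A ∈ E` has a polynomial-time verifier run with `p(n)` coins,
perfect completeness for a proof string computable in time `2^{O(n)}` (`FE`) and soundness error
`1/2`. Every result of Hirahara's paper on the path to Thm. 1.6 (1) and every ingredient of its
Lemma 3.4 other than this PCP theorem is a theorem of the tree.
[Hirahara 2021 (ECCC TR21-058), Thm. 1.6 (1) via Lemma 2.2 (1), Lemma 2.3 = Cor. 6.4, Thm. 8.9, Cor. 8.12,
Fact 8.4; Thm. 3.12, Lemma 3.4, Thm. 4.2, Lemma 5.1, Thm. 5.2; Buhrman–Fortnow–Pavan 2005, Thm. 3.1,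
Thm. 3.3, Lemma 3.4, Lemma 3.7; Köbler–Schuler 2004; Nisan–Wigderson 1994; Impagliazzo–Wigderson 1997]
[cite: Hirahara2021, Thm. 1.6 (1)] [cite: BuhrmanFortnowPavan2004, Thm. 3.3] -/
theorem hirahara_UP_DistNP_of_pcp
    (hPCP : ∀ A ∈ E, ∃ (V : PCPVerifier) (P : List Bool → List Bool) (p : Polynomial ℕ), V.IsPolyTime ∧
      (∀ n, V.coins n = p.eval n) ∧ P ∈ FE ∧
      (∀ x ∈ A, V.acceptProb x (fun i => (P x).getD i false) = 1) ∧
      (∀ x ∉ A, ∀ π : ℕ → Bool, V.acceptProb x π ≤ 1 / 2)) :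
    hirahara_UP_DistNP :=
  hirahara_UP_DistNP_of_lemma37 (BFP_lemma37_of_pcp_of_DistNP hPCP)

/-! ### `hirahara_UP_DistNP` from Buhrman–Fortnow–Pavan's Thm. 3.1 ALONE -/

/-- **Hirahara's Thm. 1.6 (1) from the named fact `BuhrmanFortnowPavan2004_PromiseBPP'_subset_PromiseP`
alone.** Under `DistNP ⊆ AvgP` the conclusion `pr-BPP = pr-P` of BFP's Thm. 3.1 already yields a language in
`E` of circuit complexity `≥ 2^{εn}` at all large `n`: the Köbler–Schuler certifier of hard truth tables
(`exists_certifier_of_DistNP_subset_AvgP`, Hirahara's Lemma 3.4, item 2) is turned into an explicit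
construction by the derandomised greedy search of `Complexity/DensePropertySearch.lean` (Goldreich 2011,
§3.3, Prop. 3.8), `HardEFromCert.exists_hard_E_of_DistNP_subset_AvgP_of_PromiseBPP'_subset`
(`MetaComplexity/AvgCaseHardEFromPromiseBPP.lean`); then `hirahara_UP_DistNP_of_hardE` applies. Hence the
discharge `hirahara_UP_DistNP_holds` is `hirahara_UP_DistNP_of_BFP BuhrmanFortnowPavan2004_PromiseBPP'_subset_PromiseP_holds`
as soon as that named fact is discharged (by BFP's Lemma 3.7 / Thm. 3.3 or otherwise).
[Hirahara 2021 (ECCC TR21-058), Thm. 1.6 (1), Lemma 3.4 (proof sketch, p. 20); Buhrman–Fortnow–Pavan 2005,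
Thm. 3.1; Goldreich 2011, §3.3, Prop. 3.8 with §3.2, Thm. 3.5] [cite: Hirahara2021, Thm. 1.6 (1)] [cite: BuhrmanFortnowPavan2004, Thm. 3.1] -/
theorem hirahara_UP_DistNP_of_BFP (hBFP : BuhrmanFortnowPavan2004_PromiseBPP'_subset_PromiseP) :
    hirahara_UP_DistNP :=
  hirahara_UP_DistNP_of_hardE fun hD =>
    HardEFromCert.exists_hard_E_of_DistNP_subset_AvgP_of_PromiseBPP'_subset hD (hBFP hD)

/-! ### `hirahara_UP_DistNP` from WEAK probabilistically checkable proofs for `E` -/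

/-- **Hirahara's Thm. 1.6 (1) from weak PCPs for `E`** — the hypothesis `hPCP` of
`hirahara_UP_DistNP_of_pcp` with the soundness error `1/2` relaxed to `1 - 1/(m(|x|)+1)` for some
polynomial `m` (the constant being immaterial: Arora–Barak 2009, Remark 11.6 (2); `m + 1` independent
repetitions, `pcpE_of_weak`). This is the form in which an algebraic verifier for `E`-computations
(Babai–Fortnow–Lund / Babai–Fortnow–Levin–Szegedy: low-degree tests and the sum-check protocol over a
prime field of polynomial size, whose error is a sum of terms `poly(n)/|𝔽|`) delivers Thm. 3.3 of
Buhrman–Fortnow–Pavan, and hence the last missing ingredient of the discharge of `hirahara_UP_DistNP`.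
[Hirahara 2021 (ECCC TR21-058), Thm. 1.6 (1); Buhrman–Fortnow–Pavan 2005, Thm. 3.3, Lemma 3.7;
Arora–Barak 2009, Remark 11.6 (2)] [cite: Hirahara2021, Thm. 1.6 (1)] [cite: BuhrmanFortnowPavan2004, Thm. 3.3] -/
theorem hirahara_UP_DistNP_of_weakPCP
    (hW : ∀ A ∈ E, ∃ (V : PCPVerifier) (P : List Bool → List Bool) (p m : Polynomial ℕ), V.IsPolyTime ∧
      (∀ n, V.coins n = p.eval n) ∧ P ∈ FE ∧
      (∀ x ∈ A, V.acceptProb x (fun i => (P x).getD i false) = 1) ∧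
      (∀ x ∉ A, ∀ π : ℕ → Bool, V.acceptProb x π ≤ 1 - 1 / (((m.eval x.length : ℕ) : ℝ) + 1))) :
    hirahara_UP_DistNP :=
  hirahara_UP_DistNP_of_pcp (pcpE_of_weak hW)


end Literature.Computability.Cryptography
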